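import Summits.CriticalPhenomena.SAWScalingLimit.Theorems.SAWDefectDecoherenceBoundaryClosureRBoundaryDataTransferFlatScale
import Summits.CriticalPhenomena.SAWScalingLimit.Theorems.SAWDefectDecoherenceBoundaryClosureRBoundaryDataTransferReflection
import HarnessLib

/-!
# Boundary data transfer, V-b: flat regularity in the limit

Route `SAWDefectDecoherence`, crux `BoundaryClosureR` (stmt-CriticalPhenomena-14004), line
`pick-half-plane`, stub `stub_engineBoundaryData` (r13): hypothesis (I4) of the landed
`pickEngine_stage2` for every engine limit `h`, at every flat point `y ≠ x` of a pinned flat piece: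

* `frequently_flatClass` — one segment class `j₀ − j_b mod 8` of the flat frame
  (`eventually_flatFrame`) is hit frequently along the mesh sequence;
* `flat_line` — the diameter near `y` is mapped into the line `h y + e^{iθ_u}ℝ`,
  `θ_u = 3πj_c/4 − π/2` (`flatLine_at`, `floorSite_value`, closedness);
* `flat_tan` — the tangential lower bound `(√3/12)C⁻¹ t ≤ ‖h(y + t) − h(y − t)‖` (`flatTan_at`);
* `flat_regularity` — (I4) at `y` by the landed Schwarz-reflection bridge `growth_of_tangential`;
* `exp_flatPhase` / `boundaryDataTransfer_flatPhase` (registered).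
-/

noncomputable section

open scoped Topology
open Filter Set
open Complex (I exp)
open Literature.Probability.LatticeModels Literature.Probability.RandomPlanarGeometry
open Literature.Probability.RandomPlanarGeometry.SAW
open Summit.CriticalPhenomena.SAWScalingLimit.Theorems.PickHalfPlane.RootWedge
open Summit.CriticalPhenomena.SAWScalingLimit.Theorems.PickHalfPlane.DevelopingMaps
open Summit.CriticalPhenomena.SAWScalingLimit.Theorems.PickHalfPlane.BoundaryExactness

namespace Summit.CriticalPhenomena.SAWScalingLimit.Theorems.PickHalfPlane.BoundaryDataTransfer

/-- The phase of the flat line: `e^{i(3πj/4 − π/2)} = −i·e^{i(3/8)·2πj}`. [folklore] -/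
theorem exp_flatPhase (jc : ℤ) :
    exp (((3 / 4 * Real.pi * jc - Real.pi / 2 : ℝ) : ℂ) * I) = -(I * exp (I * (3 / 8 : ℂ) * ((2 * Real.pi * jc : ℝ) : ℂ))) := by
  have hI : exp (-(((Real.pi / 2 : ℝ) : ℂ) * I)) = -I := by
    rw [Complex.exp_neg, Complex.exp_mul_I, ← Complex.ofReal_cos, ← Complex.ofReal_sin, Real.cos_pi_div_two,
      Real.sin_pi_div_two]
    simp [Complex.inv_I]
  rw [show ((3 / 4 * Real.pi * jc - Real.pi / 2 : ℝ) : ℂ) * I =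
      I * (3 / 8 : ℂ) * ((2 * Real.pi * jc : ℝ) : ℂ) + -(((Real.pi / 2 : ℝ) : ℂ) * I) by push_cast; ring,
    Complex.exp_add, hI]
  ring

/-- **Registered helper `boundaryDataTransfer_flatPhase`** (crux stmt-CriticalPhenomena-14004, line
`pick-half-plane`, stub `stub_engineBoundaryData`): the phase of the flat line, ∀-closed
(`exp_flatPhase`). [folklore] -/
theorem boundaryDataTransfer_flatPhase : ∀ (jc : ℤ), Complex.exp (((3 / 4 * Real.pi * jc - Real.pi / 2 : ℝ) : ℂ) * Complex.I) = -(Complex.I * Complex.exp (Complex.I * (3 / 8 : ℂ) * ((2 * Real.pi * jc : ℝ) : ℂ))) :=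
  fun jc => exp_flatPhase jc

section Frame

variable {D : DobrushinDomain} {ρ : ℝ} {Λ : ℝ → Finset HexVertex} {m : ℝ → ℤ} {b : ℝ → Sym2 HexVertex}
  (hAF : 0 < ρ ∧
    D.carrier ∩ Metric.ball (D.pt 1) ρ = {z : ℂ | (D.pt 1).im < z.im} ∩ Metric.ball (D.pt 1) ρ ∧
    (∀ᶠ δ : ℝ in 𝓝[>] 0, hexDomainSimplyConnected (Λ δ) ∧ b δ ∈ hexDomainBoundary (Λ δ) ∧
      (hexGraph.induce ((Λ δ : Finset HexVertex) : Set HexVertex)).Preconnected ∧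
      (∀ v ∈ Λ δ, (δ : ℂ) * hexCenter v ∈ D.carrier) ∧
      (∀ v : HexVertex, (δ : ℂ) * hexCenter v ∈ Metric.ball (D.pt 1) ρ →
        (v ∈ Λ δ ↔ m δ ≤ v.1 1))) ∧
    (∀ K : Set ℂ, IsCompact K → K ⊆ D.carrier →
      ∀ᶠ δ : ℝ in 𝓝[>] 0, ∀ v : HexVertex, (δ : ℂ) * hexCenter v ∈ K → v ∈ Λ δ) ∧
    Tendsto (fun δ : ℝ => (δ : ℂ) * hexMidpoint (b δ)) (𝓝[>] 0) (𝓝 (D.pt 1)))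
  {x : ℂ} {e : ℝ → Sym2 HexVertex} {r : ℝ} {mr : ℝ → ℤ}
  (hPR : 0 < r ∧ D.carrier ∩ Metric.ball x r = {z : ℂ | x.im < z.im} ∩ Metric.ball x r ∧
    (∀ᶠ δ : ℝ in 𝓝[>] 0, e δ ∈ hexDomainBoundary (Λ δ) ∧
      Nonempty (HexMidEdgeSAW (Λ δ) (e δ) (b δ)) ∧
      (∀ v : HexVertex, (δ : ℂ) * hexCenter v ∈ Metric.ball x r → (v ∈ Λ δ ↔ mr δ ≤ v.1 1))) ∧
    Tendsto (fun δ : ℝ => (δ : ℂ) * hexMidpoint (e δ)) (𝓝[>] 0) (𝓝 x))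
  (hx : x ≠ D.pt 1)
  (hSup : ∀ K : Set ℂ, IsCompact K →
    K ⊆ D.carrier ∪ (({z : ℂ | z.im = (D.pt 1).im} ∩ Metric.ball (D.pt 1) ρ) ∪
      ({z : ℂ | z.im = x.im} ∩ Metric.ball x r)) → x ∉ K →
    ∃ C : ℝ, ∀ᶠ δ : ℝ in 𝓝[>] 0, ∀ z ∈ hexDomainMidEdges (Λ δ), (δ : ℂ) * hexMidpoint z ∈ K →
      ‖hexParafermionicObservable (Λ δ) (e δ) hexCriticalFugacity (5 / 8) z‖ ≤
        C * ‖hexParafermionicObservable (Λ δ) (e δ) hexCriticalFugacity (5 / 8) (b δ)‖)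
  {ns : ℕ → ℝ} (hns : Tendsto ns atTop (𝓝[>] 0)) {h : ℂ → ℂ}
  (hcont : ContinuousOn h ((D.carrier ∪ (({z : ℂ | z.im = (D.pt 1).im} ∩ Metric.ball (D.pt 1) ρ) ∪
    ({z : ℂ | z.im = x.im} ∩ Metric.ball x r))) \ {x}))
  (hconv : ∀ K : Set ℂ, IsCompact K →
    K ⊆ (D.carrier ∪ (({z : ℂ | z.im = (D.pt 1).im} ∩ Metric.ball (D.pt 1) ρ) ∪
      ({z : ℂ | z.im = x.im} ∩ Metric.ball x r))) \ {x} →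
    ∀ ε : ℝ, 0 < ε → ∀ᶠ n : ℕ in atTop, ∀ H : Site 2 → ℂ, IsPotential (Λ (ns n)) (e (ns n)) H →
      ∀ (ub wb : HexVertex), b (ns n) = s(ub, wb) →
      ∀ sb : Site 2, sb ∈ hexFaceVertices ub → sb ∈ hexFaceVertices wb →
      ∀ s : Site 2, IsLatticeSite (Λ (ns n)) s → ((ns n : ℝ) : ℂ) * triEmbed s ∈ K →
        ‖((ns n : ℝ) : ℂ) * (H s - H sb) /
              hexParafermionicObservable (Λ (ns n)) (e (ns n)) hexCriticalFugacity (5 / 8) (b (ns n)) -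
            h (((ns n : ℝ) : ℂ) * triEmbed s)‖ < ε)

include hAF hPR hx hSup hns hcont hconv

omit hSup hcont hconv in
/-- **One segment class is hit frequently.**  In the frame of `eventually_flatFrame`, along the mesh
sequence there is an integer `j_c` such that frequently the frame holds with `j₀ − j_b ≡ j_c (mod 8)`
(pigeonhole over `ZMod 8`). [folklore] -/
theorem frequently_flatClass {p₀ : ℂ} {R₀ : ℝ} {mf : ℝ → ℤ} {bf : ℝ → Sym2 HexVertex} (hR₀ : 0 < R₀)
    (hΩ : D.carrier ∩ Metric.ball p₀ R₀ = {z : ℂ | p₀.im < z.im} ∩ Metric.ball p₀ R₀)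
    (hpin : ∀ᶠ δ : ℝ in 𝓝[>] 0, ∀ v : HexVertex,
      (δ : ℂ) * hexCenter v ∈ Metric.ball p₀ R₀ → (v ∈ Λ δ ↔ mf δ ≤ v.1 1))
    (hbd : ∀ᶠ δ : ℝ in 𝓝[>] 0, bf δ ∈ hexDomainBoundary (Λ δ))
    (hlim : Tendsto (fun δ : ℝ => (δ : ℂ) * hexMidpoint (bf δ)) (𝓝[>] 0) (𝓝 p₀))
    {y : ℂ} (hyim : y.im = p₀.im) {ρ₁ : ℝ} (hρ₁ : 0 < ρ₁) (hρ₁R : ‖y - p₀‖ + 4 * ρ₁ ≤ R₀)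
    (hρ₁x : 4 * ρ₁ ≤ ‖y - x‖) {C : ℝ} (hC : 0 < C)
    (hmass : ∀ᶠ δ : ℝ in 𝓝[>] 0, C⁻¹ * ρ₁ * ‖hexParafermionicObservable (Λ δ) (e δ) hexCriticalFugacity 0 (b δ)‖ ≤
      δ * ∑ᶠ e' ∈ {e' : Sym2 HexVertex | e' ∈ hexDomainBoundary (Λ δ) ∧
          (δ : ℂ) * hexMidpoint e' ∈ Metric.ball y ρ₁},
        ‖hexParafermionicObservable (Λ δ) (e δ) hexCriticalFugacity 0 e'‖) :
    ∃ jc : ℤ, ∃ᶠ n : ℕ in atTop, ∃ (ka kb k₀ jb j₀ : ℤ)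
      (γb : HexMidEdgeSAW (Λ (ns n)) (floorEdge ka (mr (ns n))) (floorEdge kb (m (ns n))))
      (γ₀ : HexMidEdgeSAW (Λ (ns n)) (floorEdge ka (mr (ns n))) (floorEdge k₀ (mf (ns n)))),
      e (ns n) = floorEdge ka (mr (ns n)) ∧ b (ns n) = floorEdge kb (m (ns n)) ∧
      upFace ka (mr (ns n)) ∈ Λ (ns n) ∧ belowFace ka (mr (ns n)) ∉ Λ (ns n) ∧
      upFace kb (m (ns n)) ∈ Λ (ns n) ∧ belowFace kb (m (ns n)) ∉ Λ (ns n) ∧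
      floorEdge kb (m (ns n)) ≠ floorEdge ka (mr (ns n)) ∧ γb.winding = Real.pi + 2 * Real.pi * jb ∧
      γ₀.winding = Real.pi + 2 * Real.pi * j₀ ∧ |ns n * (k₀ + mf (ns n) / 2) - y.re| < 2 * ρ₁ ∧
      (∀ k : ℤ, |ns n * (k + mf (ns n) / 2) - y.re| ≤ 2 * ρ₁ → upFace k (mf (ns n)) ∈ Λ (ns n) ∧
        belowFace k (mf (ns n)) ∉ Λ (ns n) ∧ ((![k, mf (ns n)], 1) : HexVertex) ∈ Λ (ns n) ∧
        ((![k - 1, mf (ns n)], 1) : HexVertex) ∈ Λ (ns n)) ∧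
      (∀ k : ℤ, |ns n * (k + mf (ns n) / 2) - y.re| ≤ 2 * ρ₁ → floorEdge k (mf (ns n)) ≠ floorEdge ka (mr (ns n))) ∧
      ((j₀ - jb : ℤ) : ZMod 8) = (jc : ZMod 8) := by
  have hev : ∀ᶠ n : ℕ in atTop, ∃ c : ZMod 8, ∃ (ka kb k₀ jb j₀ : ℤ)
      (γb : HexMidEdgeSAW (Λ (ns n)) (floorEdge ka (mr (ns n))) (floorEdge kb (m (ns n))))
      (γ₀ : HexMidEdgeSAW (Λ (ns n)) (floorEdge ka (mr (ns n))) (floorEdge k₀ (mf (ns n)))),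
      e (ns n) = floorEdge ka (mr (ns n)) ∧ b (ns n) = floorEdge kb (m (ns n)) ∧
      upFace ka (mr (ns n)) ∈ Λ (ns n) ∧ belowFace ka (mr (ns n)) ∉ Λ (ns n) ∧
      upFace kb (m (ns n)) ∈ Λ (ns n) ∧ belowFace kb (m (ns n)) ∉ Λ (ns n) ∧
      floorEdge kb (m (ns n)) ≠ floorEdge ka (mr (ns n)) ∧ γb.winding = Real.pi + 2 * Real.pi * jb ∧
      γ₀.winding = Real.pi + 2 * Real.pi * j₀ ∧ |ns n * (k₀ + mf (ns n) / 2) - y.re| < 2 * ρ₁ ∧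
      (∀ k : ℤ, |ns n * (k + mf (ns n) / 2) - y.re| ≤ 2 * ρ₁ → upFace k (mf (ns n)) ∈ Λ (ns n) ∧
        belowFace k (mf (ns n)) ∉ Λ (ns n) ∧ ((![k, mf (ns n)], 1) : HexVertex) ∈ Λ (ns n) ∧
        ((![k - 1, mf (ns n)], 1) : HexVertex) ∈ Λ (ns n)) ∧
      (∀ k : ℤ, |ns n * (k + mf (ns n) / 2) - y.re| ≤ 2 * ρ₁ → floorEdge k (mf (ns n)) ≠ floorEdge ka (mr (ns n))) ∧
      ((j₀ - jb : ℤ) : ZMod 8) = c := by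
    filter_upwards [hns.eventually (eventually_flatFrame hAF hPR hx hR₀ hΩ hpin hbd hlim hyim hρ₁
      hρ₁R hρ₁x hC hmass)] with n ⟨ka, kb, k₀, jb, j₀, γb, γ₀, h1, h2, h3, h4, h5, h6, h7, h8, h9, h10, h11, h12⟩
    exact ⟨_, ka, kb, k₀, jb, j₀, γb, γ₀, h1, h2, h3, h4, h5, h6, h7, h8, h9, h10, h11, h12, rfl⟩
  obtain ⟨c, hc⟩ := exists_frequently_of_eventually_exists hev
  refine ⟨((c.val : ℕ) : ℤ), hc.mono fun n ⟨ka, kb, k₀, jb, j₀, γb, γ₀, h1, h2, h3, h4, h5, h6, h7, h8, h9, h10, h11, h12, h13⟩ =>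
    ⟨ka, kb, k₀, jb, j₀, γb, γ₀, h1, h2, h3, h4, h5, h6, h7, h8, h9, h10, h11, h12, ?_⟩⟩
  rw [h13, Int.cast_natCast, ZMod.natCast_zmod_val]

omit hAF hPR hx hSup hns hcont hconv in
/-- Points of the flat piece near `y` are in the punctured closed region. [folklore] -/
theorem flatPoint_mem {p₀ : ℂ} {R₀ : ℝ}
    (hpiece : ∀ w : ℂ, w.im = p₀.im → w ∈ Metric.ball p₀ R₀ →
      w ∈ D.carrier ∪ (({z : ℂ | z.im = (D.pt 1).im} ∩ Metric.ball (D.pt 1) ρ) ∪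
        ({z : ℂ | z.im = x.im} ∩ Metric.ball x r)))
    {y : ℂ} (hyim : y.im = p₀.im) {ρ₁ : ℝ} (hρ₁R : ‖y - p₀‖ + 4 * ρ₁ ≤ R₀) (hρ₁x : 4 * ρ₁ ≤ ‖y - x‖)
    {w : ℂ} (hwim : w.im = y.im) (hwy : ‖w - y‖ < ρ₁) :
    w ∈ (D.carrier ∪ (({z : ℂ | z.im = (D.pt 1).im} ∩ Metric.ball (D.pt 1) ρ) ∪
      ({z : ℂ | z.im = x.im} ∩ Metric.ball x r))) \ {x} ∧ ‖w - p₀‖ < R₀ := by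
  have hρ₁ : 0 < ρ₁ := lt_of_le_of_lt (norm_nonneg _) hwy
  have hwR : ‖w - p₀‖ < R₀ := by
    calc ‖w - p₀‖ ≤ ‖w - y‖ + ‖y - p₀‖ := norm_sub_le_norm_sub_add_norm_sub _ _ _
      _ < R₀ := by linarith
  refine ⟨⟨hpiece w (hwim.trans hyim) (by rwa [Metric.mem_ball, dist_eq_norm]), fun h0 => ?_⟩, hwR⟩
  rw [show w = x from h0, norm_sub_rev] at hwy
  linarith

omit hAF hPR hx hSup hns hcont hconv in
/-- Points of the flat piece near `y`, second form. [folklore] -/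
theorem flatPoint_mem' {p₀ : ℂ} {R₀ : ℝ}
    (hpiece : ∀ w : ℂ, w.im = p₀.im → w ∈ Metric.ball p₀ R₀ →
      w ∈ D.carrier ∪ (({z : ℂ | z.im = (D.pt 1).im} ∩ Metric.ball (D.pt 1) ρ) ∪
        ({z : ℂ | z.im = x.im} ∩ Metric.ball x r)))
    {y : ℂ} (hyim : y.im = p₀.im) {ρ₁ : ℝ} (hρ₁R : ‖y - p₀‖ + 4 * ρ₁ ≤ R₀) (hρ₁x : 4 * ρ₁ ≤ ‖y - x‖)
    {t : ℝ} (ht : |t| < ρ₁) :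
    (y + (t : ℂ)) ∈ (D.carrier ∪ (({z : ℂ | z.im = (D.pt 1).im} ∩ Metric.ball (D.pt 1) ρ) ∪
      ({z : ℂ | z.im = x.im} ∩ Metric.ball x r))) \ {x} ∧ ‖y + (t : ℂ) - p₀‖ < R₀ ∧
      (y + (t : ℂ)).im = p₀.im ∧ (y + (t : ℂ)).re = y.re + t := by
  have h := flatPoint_mem (D := D) (ρ := ρ) (x := x) (r := r) hpiece hyim hρ₁R hρ₁x (w := y + (t : ℂ)) (by simp)
    (by rw [add_sub_cancel_left, Complex.norm_real, Real.norm_eq_abs]; exact ht)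
  exact ⟨h.1, h.2, by simp [hyim], by simp⟩

/-- **The flat line in the limit.**  In the frame of a pinned flat piece at `y ≠ x`, for the segment
class `j_c` hit frequently along the sequence: for `z` on the piece within `ρ₁` of `y`,
`Im(e^{−iθ_u}(h z − h y)) = 0` with `e^{iθ_u} = −i e^{i(3/8)2πj_c}`, `θ_u = 3πj_c/4 − π/2`
(`flatLine_at` at a good scale, `floorSite_value`, closedness). [cite: DuminilCopinSmirnov2012, §4 (the map H with dH = F dz)] -/
theorem flat_line {p₀ : ℂ} {R₀ : ℝ} {mf : ℝ → ℤ} {bf : ℝ → Sym2 HexVertex} (hR₀ : 0 < R₀)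
    (hΩ : D.carrier ∩ Metric.ball p₀ R₀ = {z : ℂ | p₀.im < z.im} ∩ Metric.ball p₀ R₀)
    (hpin : ∀ᶠ δ : ℝ in 𝓝[>] 0, ∀ v : HexVertex,
      (δ : ℂ) * hexCenter v ∈ Metric.ball p₀ R₀ → (v ∈ Λ δ ↔ mf δ ≤ v.1 1))
    (hbd : ∀ᶠ δ : ℝ in 𝓝[>] 0, bf δ ∈ hexDomainBoundary (Λ δ))
    (hlim : Tendsto (fun δ : ℝ => (δ : ℂ) * hexMidpoint (bf δ)) (𝓝[>] 0) (𝓝 p₀))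
    (hpiece : ∀ w : ℂ, w.im = p₀.im → w ∈ Metric.ball p₀ R₀ →
      w ∈ D.carrier ∪ (({z : ℂ | z.im = (D.pt 1).im} ∩ Metric.ball (D.pt 1) ρ) ∪
        ({z : ℂ | z.im = x.im} ∩ Metric.ball x r)))
    {y : ℂ} (hyim : y.im = p₀.im) {ρ₁ : ℝ} (hρ₁ : 0 < ρ₁) (hρ₁R : ‖y - p₀‖ + 4 * ρ₁ ≤ R₀)
    (hρ₁x : 4 * ρ₁ ≤ ‖y - x‖) {jc : ℤ}
    (hcl : ∃ᶠ n : ℕ in atTop, ∃ (ka kb k₀ jb j₀ : ℤ)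
      (γb : HexMidEdgeSAW (Λ (ns n)) (floorEdge ka (mr (ns n))) (floorEdge kb (m (ns n))))
      (γ₀ : HexMidEdgeSAW (Λ (ns n)) (floorEdge ka (mr (ns n))) (floorEdge k₀ (mf (ns n)))),
      e (ns n) = floorEdge ka (mr (ns n)) ∧ b (ns n) = floorEdge kb (m (ns n)) ∧
      upFace ka (mr (ns n)) ∈ Λ (ns n) ∧ belowFace ka (mr (ns n)) ∉ Λ (ns n) ∧
      upFace kb (m (ns n)) ∈ Λ (ns n) ∧ belowFace kb (m (ns n)) ∉ Λ (ns n) ∧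
      floorEdge kb (m (ns n)) ≠ floorEdge ka (mr (ns n)) ∧ γb.winding = Real.pi + 2 * Real.pi * jb ∧
      γ₀.winding = Real.pi + 2 * Real.pi * j₀ ∧ |ns n * (k₀ + mf (ns n) / 2) - y.re| < 2 * ρ₁ ∧
      (∀ k : ℤ, |ns n * (k + mf (ns n) / 2) - y.re| ≤ 2 * ρ₁ → upFace k (mf (ns n)) ∈ Λ (ns n) ∧
        belowFace k (mf (ns n)) ∉ Λ (ns n) ∧ ((![k, mf (ns n)], 1) : HexVertex) ∈ Λ (ns n) ∧
        ((![k - 1, mf (ns n)], 1) : HexVertex) ∈ Λ (ns n)) ∧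
      (∀ k : ℤ, |ns n * (k + mf (ns n) / 2) - y.re| ≤ 2 * ρ₁ → floorEdge k (mf (ns n)) ≠ floorEdge ka (mr (ns n))) ∧
      ((j₀ - jb : ℤ) : ZMod 8) = (jc : ZMod 8))
    {z : ℂ} (hzim : z.im = y.im) (hzy : ‖z - y‖ < ρ₁) :
    (exp (-(((3 / 4 * Real.pi * jc - Real.pi / 2 : ℝ) : ℂ) * I)) * (h z - h y)).im = 0 := by
  apply im_rot_eq_zero_of_forall_approx
  intro ε hε
  obtain ⟨hzU, hzR⟩ := flatPoint_mem (D := D) hpiece hyim hρ₁R hρ₁x hzim hzy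
  obtain ⟨hyU, hyR⟩ := flatPoint_mem (D := D) hpiece hyim hρ₁R hρ₁x (w := y) rfl
    (by rw [sub_self, norm_zero]; exact hρ₁)
  have hvz := floorSite_value hAF hPR hx hSup hns hcont hconv hR₀ hΩ hpin hbd hlim hzU (hzim.trans hyim) hzR
    (half_pos hε)
  have hvy := floorSite_value hAF hPR hx hSup hns hcont hconv hR₀ hΩ hpin hbd hlim hyU hyim hyR (half_pos hε)
  have hδev : ∀ᶠ δ : ℝ in 𝓝[>] 0, δ ∈ Set.Ioo 0 ρ₁ := Ioo_mem_nhdsGT hρ₁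
  obtain ⟨n, ⟨ka, kb, k₀, jb, j₀, γb, γ₀, he, hb, hUa, hBa, hUb, hBb, hneb, hwb, hw₀, hk₀, hW, hroot, hclass⟩, hvzn,
    hvyn, ⟨hδ0, hδρ⟩, hsc, hbdn⟩ :=
    (hcl.and_eventually (hvz.and (hvy.and ((hns.eventually hδev).and
      ((hns.eventually (hAF.2.2.1.mono fun _ h => h.1)).and (hns.eventually (hPR.2.2.1.mono fun _ h => h.1))))))).exists
  obtain ⟨H, hH⟩ := potentialExists_proof (Λ (ns n)) hsc (e (ns n)) hbdn
  have hb' : b (ns n) = s(belowFace kb (m (ns n)), upFace kb (m (ns n))) := hb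
  obtain ⟨-, -, hvaz⟩ := hvzn H hH _ _ hb' _ (floorSite_mem_belowFace kb (m (ns n))) (floorSite_mem_upFace kb (m (ns n)))
  obtain ⟨-, -, hvay⟩ := hvyn H hH _ _ hb' _ (floorSite_mem_belowFace kb (m (ns n))) (floorSite_mem_upFace kb (m (ns n)))
  have hzy' : |z.re - y.re| < ρ₁ := by
    have := Complex.abs_re_le_norm (z - y); rw [Complex.sub_re] at this; exact lt_of_le_of_lt this hzy
  have key := flatLine_at hsc hδ0 hδρ.le he hb hUa hBa hUb hBb hneb γb hwb γ₀ hw₀ hclass hk₀ hW hroot hH hzy' hvaz hvay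
  rwa [← exp_flatPhase jc] at key

/-- **The tangential lower bound in the limit.**  In the frame of a pinned flat piece at `y ≠ x` with
the lower window-mass bound of `FlatMassLaws` (a) (constant `C`, radii `≤ ρ₁`): for `0 < t < ρ₁`,
`(√3/12)C⁻¹·t ≤ ‖h(y + t) − h(y − t)‖` (`flatTan_at` at a good scale, `floorSite_value`, `ε → 0`).
[cite: DuminilCopinSmirnov2012, §4 (the map H with dH = F dz)] -/
theorem flat_tan
    {p₀ : ℂ} {R₀ : ℝ} {mf : ℝ → ℤ} {bf : ℝ → Sym2 HexVertex} (hR₀ : 0 < R₀)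
    (hΩ : D.carrier ∩ Metric.ball p₀ R₀ = {z : ℂ | p₀.im < z.im} ∩ Metric.ball p₀ R₀)
    (hpin : ∀ᶠ δ : ℝ in 𝓝[>] 0, ∀ v : HexVertex,
      (δ : ℂ) * hexCenter v ∈ Metric.ball p₀ R₀ → (v ∈ Λ δ ↔ mf δ ≤ v.1 1))
    (hbd : ∀ᶠ δ : ℝ in 𝓝[>] 0, bf δ ∈ hexDomainBoundary (Λ δ))
    (hlim : Tendsto (fun δ : ℝ => (δ : ℂ) * hexMidpoint (bf δ)) (𝓝[>] 0) (𝓝 p₀))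
    (hpiece : ∀ w : ℂ, w.im = p₀.im → w ∈ Metric.ball p₀ R₀ →
      w ∈ D.carrier ∪ (({z : ℂ | z.im = (D.pt 1).im} ∩ Metric.ball (D.pt 1) ρ) ∪
        ({z : ℂ | z.im = x.im} ∩ Metric.ball x r)))
    {y : ℂ} (hyim : y.im = p₀.im) {ρ₁ : ℝ} (hρ₁ : 0 < ρ₁) (hρ₁R : ‖y - p₀‖ + 4 * ρ₁ ≤ R₀)
    (hρ₁x : 4 * ρ₁ ≤ ‖y - x‖) {C : ℝ} (hC : 0 < C)
    (hmass : ∀ ρ' : ℝ, 0 < ρ' → ρ' ≤ ρ₁ → ∀ᶠ δ : ℝ in 𝓝[>] 0,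
      C⁻¹ * ρ' * ‖hexParafermionicObservable (Λ δ) (e δ) hexCriticalFugacity 0 (b δ)‖ ≤
      δ * ∑ᶠ e' ∈ {e' : Sym2 HexVertex | e' ∈ hexDomainBoundary (Λ δ) ∧
          (δ : ℂ) * hexMidpoint e' ∈ Metric.ball y ρ'},
        ‖hexParafermionicObservable (Λ δ) (e δ) hexCriticalFugacity 0 e'‖)
    {t : ℝ} (ht0 : 0 < t) (htρ : t < ρ₁) :
    Real.sqrt 3 / 12 * C⁻¹ * t ≤ ‖h (y + t) - h (y - t)‖ := by
  refine le_of_forall_pos_lt_add fun ε hε => ?_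
  obtain ⟨hpU, hpR, hpim, hpre⟩ := flatPoint_mem' (D := D) hpiece hyim hρ₁R hρ₁x (t := t) (by rwa [abs_of_pos ht0])
  obtain ⟨hmU, hmR, hmim, hmre⟩ := flatPoint_mem' (D := D) hpiece hyim hρ₁R hρ₁x (t := -t)
    (by rwa [abs_neg, abs_of_pos ht0])
  have hvp := floorSite_value hAF hPR hx hSup hns hcont hconv hR₀ hΩ hpin hbd hlim hpU hpim hpR
    (show (0 : ℝ) < ε / 4 by positivity)
  have hvm := floorSite_value hAF hPR hx hSup hns hcont hconv hR₀ hΩ hpin hbd hlim hmU hmim hmR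
    (show (0 : ℝ) < ε / 4 by positivity)
  have hδev : ∀ᶠ δ : ℝ in 𝓝[>] 0, δ ∈ Set.Ioo 0 t := Ioo_mem_nhdsGT ht0
  obtain ⟨n, ⟨ka, kb, k₀, jb, j₀, γb, γ₀, he, hb, hUa, hBa, hUb, hBb, hneb, -, -, hk₀, hW, hroot⟩, hvpn, hvmn,
    ⟨hδ0, hδt⟩, hsc, hbdn, hpinn, hmassn⟩ :=
    ((hns.eventually (eventually_flatFrame hAF hPR hx hR₀ hΩ hpin hbd hlim hyim hρ₁ hρ₁R hρ₁x hC (hmass ρ₁ hρ₁ le_rfl))).and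
      (hvp.and (hvm.and ((hns.eventually hδev).and ((hns.eventually (hAF.2.2.1.mono fun _ h => h.1)).and
        ((hns.eventually (hPR.2.2.1.mono fun _ h => h.1)).and ((hns.eventually hpin).and
          (hns.eventually (hmass (t / 2) (half_pos ht0) (by linarith)))))))))).exists
  obtain ⟨H, hH⟩ := potentialExists_proof (Λ (ns n)) hsc (e (ns n)) hbdn
  have hb' : b (ns n) = s(belowFace kb (m (ns n)), upFace kb (m (ns n))) := hb
  obtain ⟨-, -, hvap⟩ := hvpn H hH _ _ hb' _ (floorSite_mem_belowFace kb (m (ns n))) (floorSite_mem_upFace kb (m (ns n)))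
  obtain ⟨-, -, hvam⟩ := hvmn H hH _ _ hb' _ (floorSite_mem_belowFace kb (m (ns n))) (floorSite_mem_upFace kb (m (ns n)))
  have key := flatTan_at (ε := ε / 2) hsc hδ0 hδt.le htρ he hb hUa hBa hUb hBb hneb γb γ₀ hk₀ hW hroot hpinn (by linarith) hH
    hpre (by rw [hmre]; ring) hmassn (hvap.trans_eq (by ring)) (hvam.trans_eq (by ring))
  rw [show y + ((-t : ℝ) : ℂ) = y - t by push_cast; ring] at key
  linarith

/-- **(I4) of `pickEngine_stage2` at a flat point of a pinned piece.**  In the frame of a pinned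
flat piece (one of the two pieces of the closed region), for `y ≠ x` on the piece, a radius `ρ₁`
with `‖y − p₀‖ + 4ρ₁ ≤ R₀`, `4ρ₁ ≤ ‖y − x‖`, and the lower window-mass bound of `FlatMassLaws` (a)
at radii `≤ ρ₁`: there are `ρ' > 0`, `θ'`, `p'`, `c' > 0` with `h` continuous on the closed upper
half-disc `{im ≥ im y} ∩ B(y, ρ')`, the diameter mapped into the line `p' + e^{iθ'}ℝ`, and
`c'·t ≤ |Im(e^{−iθ'}(h(y + it) − p'))|` (`flat_line`, `flat_tan`, then the landed Schwarz-reflection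
bridge `growth_of_tangential`). [cite: DuminilCopinSmirnov2012, §4 (the map H with dH = F dz)] -/
theorem flat_regularity (hhol : DifferentiableOn ℂ h D.carrier)
    {p₀ : ℂ} {R₀ : ℝ} {mf : ℝ → ℤ} {bf : ℝ → Sym2 HexVertex} (hR₀ : 0 < R₀)
    (hΩ : D.carrier ∩ Metric.ball p₀ R₀ = {z : ℂ | p₀.im < z.im} ∩ Metric.ball p₀ R₀)
    (hpin : ∀ᶠ δ : ℝ in 𝓝[>] 0, ∀ v : HexVertex,
      (δ : ℂ) * hexCenter v ∈ Metric.ball p₀ R₀ → (v ∈ Λ δ ↔ mf δ ≤ v.1 1))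
    (hbd : ∀ᶠ δ : ℝ in 𝓝[>] 0, bf δ ∈ hexDomainBoundary (Λ δ))
    (hlim : Tendsto (fun δ : ℝ => (δ : ℂ) * hexMidpoint (bf δ)) (𝓝[>] 0) (𝓝 p₀))
    (hpiece : ∀ w : ℂ, w.im = p₀.im → w ∈ Metric.ball p₀ R₀ →
      w ∈ D.carrier ∪ (({z : ℂ | z.im = (D.pt 1).im} ∩ Metric.ball (D.pt 1) ρ) ∪
        ({z : ℂ | z.im = x.im} ∩ Metric.ball x r)))
    {y : ℂ} (hyim : y.im = p₀.im) {ρ₁ : ℝ} (hρ₁ : 0 < ρ₁) (hρ₁R : ‖y - p₀‖ + 4 * ρ₁ ≤ R₀)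
    (hρ₁x : 4 * ρ₁ ≤ ‖y - x‖) {C : ℝ} (hC : 0 < C)
    (hmass : ∀ ρ' : ℝ, 0 < ρ' → ρ' ≤ ρ₁ → ∀ᶠ δ : ℝ in 𝓝[>] 0,
      C⁻¹ * ρ' * ‖hexParafermionicObservable (Λ δ) (e δ) hexCriticalFugacity 0 (b δ)‖ ≤
      δ * ∑ᶠ e' ∈ {e' : Sym2 HexVertex | e' ∈ hexDomainBoundary (Λ δ) ∧
          (δ : ℂ) * hexMidpoint e' ∈ Metric.ball y ρ'},
        ‖hexParafermionicObservable (Λ δ) (e δ) hexCriticalFugacity 0 e'‖) :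
    ∃ ρ' : ℝ, 0 < ρ' ∧ ∃ θ' : ℝ, ∃ p' : ℂ, ∃ c' : ℝ, 0 < c' ∧
      ContinuousOn h ({z : ℂ | y.im ≤ z.im} ∩ Metric.ball y ρ') ∧
      (∀ z ∈ Metric.ball y ρ', z.im = y.im →
        (Complex.exp (-((θ' : ℂ) * Complex.I)) * (h z - p')).im = 0) ∧
      (∀ t : ℝ, 0 < t → t < ρ' → c' * t ≤
        |(Complex.exp (-((θ' : ℂ) * Complex.I)) * (h (y + (t : ℂ) * Complex.I) - p')).im|) := by
  obtain ⟨jc, hcl⟩ := frequently_flatClass hAF hPR hx hns hR₀ hΩ hpin hbd hlim hyim hρ₁ hρ₁R hρ₁x hC (hmass ρ₁ hρ₁ le_rfl)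
  set θu : ℝ := 3 / 4 * Real.pi * jc - Real.pi / 2 with hθu
  set u : ℂ := exp ((θu : ℂ) * I) with hu
  have hun : ‖u‖ = 1 := by rw [hu, Complex.norm_exp_ofReal_mul_I]
  -- the half-disc is in the carrier / the closed region
  have hsub : ∀ {w : ℂ}, y.im ≤ w.im → w ∈ Metric.ball y ρ₁ →
      (y.im < w.im → w ∈ D.carrier) ∧
      w ∈ (D.carrier ∪ (({z : ℂ | z.im = (D.pt 1).im} ∩ Metric.ball (D.pt 1) ρ) ∪
        ({z : ℂ | z.im = x.im} ∩ Metric.ball x r))) \ {x} := by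
    intro w hwim hwb
    rw [Metric.mem_ball, dist_eq_norm] at hwb
    have hwR : ‖w - p₀‖ < R₀ := by
      calc ‖w - p₀‖ ≤ ‖w - y‖ + ‖y - p₀‖ := norm_sub_le_norm_sub_add_norm_sub _ _ _
        _ < R₀ := by linarith
    have hwx : w ≠ x := fun h0 => by rw [h0, norm_sub_rev] at hwb; linarith
    have hcar : y.im < w.im → w ∈ D.carrier := fun hlt => by
      have : w ∈ {z : ℂ | p₀.im < z.im} ∩ Metric.ball p₀ R₀ :=
        ⟨by rw [Set.mem_setOf_eq, ← hyim]; exact hlt, by rwa [Metric.mem_ball, dist_eq_norm]⟩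
      rw [← hΩ] at this
      exact this.1
    refine ⟨hcar, ?_, hwx⟩
    rcases hwim.lt_or_eq with hlt | heq
    · exact Or.inl (hcar hlt)
    · exact (flatPoint_mem (D := D) hpiece hyim hρ₁R hρ₁x heq.symm hwb).1.1
  have hdiff : DifferentiableOn ℂ h ({z : ℂ | y.im < z.im} ∩ Metric.ball y ρ₁) :=
    hhol.mono fun w hw => (hsub (le_of_lt hw.1) hw.2).1 hw.1
  have hcontH : ContinuousOn h ({z : ℂ | y.im ≤ z.im} ∩ Metric.ball y ρ₁) :=
    hcont.mono fun w hw => (hsub hw.1 hw.2).2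
  have hline : ∀ z ∈ Metric.ball y ρ₁, z.im = y.im → ∃ s : ℝ, h z - h y = u * s := by
    intro z hz hzim
    rw [Metric.mem_ball, dist_eq_norm] at hz
    exact exists_real_of_im_eq_zero
      (flat_line hAF hPR hx hSup hns hcont hconv hR₀ hΩ hpin hbd hlim hpiece hyim hρ₁ hρ₁R hρ₁x hcl hzim hz)
  have htan : ∀ t : ℝ, 0 < t → t < ρ₁ → Real.sqrt 3 / 12 * C⁻¹ * t ≤ ‖h (y + t) - h (y - t)‖ := fun t ht0 htρ =>
    flat_tan hAF hPR hx hSup hns hcont hconv hR₀ hΩ hpin hbd hlim hpiece hyim hρ₁ hρ₁R hρ₁x hC hmass ht0 htρ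
  obtain ⟨ρ', hρ', hρ'ρ, c', hc', hline', hgrowth'⟩ :=
    growth_of_tangential hρ₁ (by positivity : (0 : ℝ) < Real.sqrt 3 / 12 * C⁻¹) hun hdiff hcontH hline htan
  exact ⟨ρ', hρ', u.arg, h y, c', hc',
    hcontH.mono (Set.inter_subset_inter_right _ (Metric.ball_subset_ball hρ'ρ)), hline', hgrowth'⟩

end Frame

end Summit.CriticalPhenomena.SAWScalingLimit.Theorems.PickHalfPlane.BoundaryDataTransfer

end
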